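import Literature.NumberTheory.Sieve.FGKMT2018LocalClassCount
import Literature.NumberTheory.Sieve.FGKMT2018SieveWeightSupport
import Literature.NumberTheory.Sieve.FGKMT2018SieveWeightExpansion
import Literature.NumberTheory.Sieve.FGKMT2018Theorem6Decomposition
import HarnessLib

/-!
# FGKMT 2018 (7.5)–(7.9) / Maynard 2016 Prop. 9.1: the vectors `d, e ∈ 𝒟_k(𝓛)` and their classes

Sources: J. Maynard, *Dense clusters of primes in subsets*, Compositio Math. 152 (2016) =
arXiv:1405.2593 [Maynard2016DenseClusters], proof of Proposition 9.1 p. 19 («By our choice of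
support of the `λ_d`, there is no contribution unless `(d_i e_i, d_j e_j) = 1` for all `i ≠ j`. In
this case, given `d, e ∈ 𝒟_k` (so in particular `(d_j e_j, a_j W) = 1` for `1 ≤ j ≤ k`), we can
combine the congruence conditions by the Chinese remainder theorem, and see that the inner sum is
`#𝒜(x; q, a)` for some `a` and `q = W[d, e]`»), §7 p. 13 (the index convention `j_{p,a}` in `𝒟_k`);
K. Ford, B. Green, S. Konyagin, J. Maynard, T. Tao, *Long gaps between primes*, JAMS 31 (2018) =
arXiv:1412.5029v4 [FordGreenKonyaginMaynardTao2018], (7.5) p. 21.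

PROVED here (no named facts) for the pinned `FGKMT2018.dkBox`:

* `squarefree_wCut` (`W = ∏_{p ≤ 2k², p ∤ B} p` is squarefree);
* structure of `d ∈ 𝒟_k(𝓛)`: `coprime_apply_of_mem_dkBox` (`(d_i, d_j) = 1`, `i ≠ j`),
  `squarefree_apply_of_mem_dkBox`, `coprime_apply_wCut_of_mem_dkBox` (`(d_i, W) = 1`),
  `not_dvd_fst_of_mem_dkBox` / `intGcd_fst_eq_one_of_mem_dkBox` (`p ∣ d_i ⇒ p ∤ a_i`, so
  `(a_i, d_i) = 1`, for admissible `𝓛`);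
* `root_unique` (`p ∤ a`, `p ∣ L(n), L(n') ⇒ n ≡ n' (mod p)`);
* **`joint_dvd_empty_of_not_cross_coprime`** — the «no contribution» clause: if `d, e ∈ 𝒟_k(𝓛)`
  and a prime divides `d_i` and `e_j` with `i ≠ j`, then NO integer `n` has `d_ι ∣ L_ι(n)` and
  `e_ι ∣ L_ι(n)` for all `ι` (the index convention of `𝒟_k` and uniqueness of roots);
  `cross_coprime_or_empty` (the dichotomy);
* **`abs_card_dyadZ_pair_sub_le`** — for cross-coprime `d, e ∈ 𝒟_k(𝓛)`:
  `|#{n ∈ 𝒜(X) : (L_ι(n), W) = 1, d_ι ∣ L_ι(n), e_ι ∣ L_ι(n) ∀ι} − #𝒜(X) φ_ω(W)/(W ∏ [d_ι, e_ι])| ≤ φ_ω(W)`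
  (`abs_card_dyadZ_localSystem_sub_le` with `m_ι = [d_ι, e_ι]`); `card_pair_filter_eq_zero`;
* **`abs_sum_sieveWt_sub_quadForm_le`** — the first step of the proof of Proposition 9.1 for `𝒜 = ℤ`
  and ANY `F`: `|∑_{X<n≤2X} w_n − #𝒜(X)(φ_ω(W)/W) ∑_{d,e cross-coprime} λ_dλ_e/∏[d_ι,e_ι]| ≤ φ_ω(W)(∑_d|λ_d|)²`.

## References
* J. Maynard, *Dense clusters of primes in subsets*, Compositio Math. 152 (2016), §7, proof of
  Prop. 9.1 [Maynard2016DenseClusters].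
* K. Ford, B. Green, S. Konyagin, J. Maynard, T. Tao, *Long gaps between primes*, JAMS 31 (2018),
  (7.5) [FordGreenKonyaginMaynardTao2018].
-/

noncomputable section

open Finset

namespace Literature.NumberTheory.Sieve.FGKMT2018

variable {k : ℕ}

/-! ### `W` and the fields of `𝒟_k(𝓛)` -/

/-- `W = ∏_{p ≤ 2k², p ∤ B} p` is squarefree (a product of distinct primes; cf.
`FordMaynard.squarefree_prod_of_primes` in `FordMaynardSequence`, not imported here to keep the
closure small). [cite: FordGreenKonyaginMaynardTao2018, §7 p. 21 (definition of W)] -/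
theorem squarefree_wCut (k B : ℕ) : Squarefree (wCut k B) := by
  classical
  unfold wCut
  -- induction over the (filtered) finset of primes
  suffices h : ∀ s : Finset ℕ, (∀ p ∈ s, p.Prime) → Squarefree (∏ p ∈ s, p) from
    h _ fun p hp => (Finset.mem_filter.1 hp).2.1
  intro s hs
  induction s using Finset.induction_on with
  | empty => simp
  | insert a s ha ih =>
    rw [Finset.prod_insert ha, Nat.squarefree_mul_iff]
    have hap : a.Prime := hs a (Finset.mem_insert_self a s)
    have hs' : ∀ p ∈ s, p.Prime := fun p hp => hs p (Finset.mem_insert_of_mem hp)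
    refine ⟨Nat.Coprime.prod_right fun p hp => (Nat.coprime_primes hap (hs' p hp)).2 ?_,
      hap.squarefree, ih hs'⟩
    rintro rfl; exact ha hp

/-- Distinct coordinates of a vector with squarefree product are coprime.
[cite: FordGreenKonyaginMaynardTao2018, (7.5) p. 21 (μ²(d₁⋯d_k) = 1)] -/
theorem coprime_apply_of_squarefree_prod {d : Fin k → ℕ} (h : Squarefree (∏ i, d i)) {i j : Fin k}
    (hij : i ≠ j) : (d i).Coprime (d j) := by
  classical
  refine Nat.coprime_of_dvd fun p hp hpi hpj => ?_
  have hdvd : d i * d j ∣ ∏ l, d l := by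
    rw [← Finset.mul_prod_erase Finset.univ d (Finset.mem_univ i)]
    exact mul_dvd_mul_left _ (Finset.dvd_prod_of_mem _ (Finset.mem_erase.2 ⟨hij.symm, Finset.mem_univ j⟩))
  have hpp : p * p ∣ ∏ l, d l := (mul_dvd_mul hpi hpj).trans hdvd
  exact hp.not_isUnit (h p hpp)

/-- `d ∈ 𝒟_k(𝓛) ⇒ (d_i, d_j) = 1` for `i ≠ j`. [cite: FordGreenKonyaginMaynardTao2018, (7.5) p. 21] -/
theorem coprime_apply_of_mem_dkBox {L : Fin k → ℤ × ℤ} {B : ℕ} {R : ℝ} {d : Fin k → ℕ}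
    (hd : d ∈ dkBox L B R) {i j : Fin k} (hij : i ≠ j) : (d i).Coprime (d j) :=
  coprime_apply_of_squarefree_prod (squarefree_of_mem_dkBox hd) hij

/-- `d ∈ 𝒟_k(𝓛) ⇒ d_i` squarefree. [cite: FordGreenKonyaginMaynardTao2018, (7.5) p. 21] -/
theorem squarefree_apply_of_mem_dkBox {L : Fin k → ℤ × ℤ} {B : ℕ} {R : ℝ} {d : Fin k → ℕ}
    (hd : d ∈ dkBox L B R) (i : Fin k) : Squarefree (d i) :=
  Squarefree.squarefree_of_dvd (Finset.dvd_prod_of_mem _ (Finset.mem_univ i))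
    (squarefree_of_mem_dkBox hd)

/-- `d ∈ 𝒟_k(𝓛) ⇒ (d_i, W B) = 1`, in particular `(d_i, W) = 1`.
[cite: FordGreenKonyaginMaynardTao2018, (7.5) p. 21 ((d₁⋯d_k, WB) = 1)] -/
theorem coprime_apply_wCut_mul_of_mem_dkBox {L : Fin k → ℤ × ℤ} {B : ℕ} {R : ℝ} {d : Fin k → ℕ}
    (hd : d ∈ dkBox L B R) (i : Fin k) : (d i).Coprime (wCut k B * B) :=
  Nat.Coprime.coprime_dvd_left (Finset.dvd_prod_of_mem _ (Finset.mem_univ i))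
    (coprime_of_mem_dkBox hd)

/-- `d ∈ 𝒟_k(𝓛) ⇒ (d_i, W) = 1`. [cite: FordGreenKonyaginMaynardTao2018, (7.5) p. 21] -/
theorem coprime_apply_wCut_of_mem_dkBox {L : Fin k → ℤ × ℤ} {B : ℕ} {R : ℝ} {d : Fin k → ℕ}
    (hd : d ∈ dkBox L B R) (i : Fin k) : (d i).Coprime (wCut k B) :=
  Nat.Coprime.coprime_dvd_right (Dvd.intro B rfl) (coprime_apply_wCut_mul_of_mem_dkBox hd i)

/-- The index convention of `𝒟_k(𝓛)`: a prime `p ∣ d_j` has a root `n` of `L_j mod p` at which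
no earlier form vanishes. [cite: Maynard2016DenseClusters, §7 p. 13 (j = j_{p,a}); FordGreenKonyaginMaynardTao2018, (7.5) p. 21] -/
theorem exists_root_of_mem_dkBox {L : Fin k → ℤ × ℤ} {B : ℕ} {R : ℝ} {d : Fin k → ℕ}
    (hd : d ∈ dkBox L B R) (j : Fin k) {p : ℕ} (hp : p ∈ (d j).primeFactors) :
    ∃ n ∈ Finset.range p, (p : ℤ) ∣ formEval (L j) n ∧
      ∀ j' : Fin k, j' < j → ¬ (p : ℤ) ∣ formEval (L j') n := by
  unfold dkBox at hd
  exact (Finset.mem_filter.1 hd).2.2.2 j p hp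

/-- For admissible `𝓛`: a prime `p ∣ d_i` (`d ∈ 𝒟_k(𝓛)`) does not divide `a_i` (else it divides
`b_i` too, contradicting `(a_i, b_i) = 1`). [cite: Maynard2016DenseClusters, proof of Prop. 9.1 p. 19 («(d_j e_j, a_j W) = 1»)] -/
theorem not_dvd_fst_of_mem_dkBox {L : Fin k → ℤ × ℤ} (hadm : FormsAdmissible L) {B : ℕ} {R : ℝ}
    {d : Fin k → ℕ} (hd : d ∈ dkBox L B R) (i : Fin k) {p : ℕ} (hp : p ∈ (d i).primeFactors) :
    ¬ (p : ℤ) ∣ (L i).1 := by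
  intro hpa
  obtain ⟨n, -, hpn, -⟩ := exists_root_of_mem_dkBox hd i hp
  have hpb : (p : ℤ) ∣ (L i).2 := by
    have : (L i).2 = formEval (L i) n - (L i).1 * n := by unfold formEval; ring
    rw [this]; exact dvd_sub hpn (hpa.mul_right _)
  have hg : p ∣ Int.gcd (L i).1 (L i).2 := Int.dvd_gcd hpa hpb
  rw [intGcd_eq_one_of_formsAdmissible hadm i] at hg
  exact (Nat.prime_of_mem_primeFactors hp).ne_one (Nat.dvd_one.1 hg)

/-- Hence `(a_i, d_i) = 1` for `d ∈ 𝒟_k(𝓛)`, `𝓛` admissible.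
[cite: Maynard2016DenseClusters, proof of Prop. 9.1 p. 19 («(d_j e_j, a_j W) = 1»)] -/
theorem intGcd_fst_eq_one_of_mem_dkBox {L : Fin k → ℤ × ℤ} (hadm : FormsAdmissible L) {B : ℕ}
    {R : ℝ} {d : Fin k → ℕ} (hd : d ∈ dkBox L B R) (i : Fin k) : Int.gcd (L i).1 (d i) = 1 := by
  rw [Int.gcd_eq_natAbs, Int.natAbs_natCast]
  refine Nat.Coprime.gcd_eq_one (Nat.Coprime.symm (Nat.coprime_of_dvd fun p hp hpd hpa => ?_))
  have hd0 : d i ≠ 0 := Nat.one_le_iff_ne_zero.1 (one_le_of_mem_dkBox hd i)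
  exact not_dvd_fst_of_mem_dkBox hadm hd i (Nat.mem_primeFactors.2 ⟨hp, hpd, hd0⟩)
    (Int.natCast_dvd.2 hpa)

/-- `(a_i, [d_i, e_i]) = 1` for `d, e ∈ 𝒟_k(𝓛)`, `𝓛` admissible.
[cite: Maynard2016DenseClusters, proof of Prop. 9.1 p. 19 («(d_j e_j, a_j W) = 1»)] -/
theorem intGcd_fst_lcm_eq_one_of_mem_dkBox {L : Fin k → ℤ × ℤ} (hadm : FormsAdmissible L) {B : ℕ}
    {R : ℝ} {d e : Fin k → ℕ} (hd : d ∈ dkBox L B R) (he : e ∈ dkBox L B R) (i : Fin k) :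
    Int.gcd (L i).1 (Nat.lcm (d i) (e i)) = 1 := by
  have h1 := intGcd_fst_eq_one_of_mem_dkBox hadm hd i
  have h2 := intGcd_fst_eq_one_of_mem_dkBox hadm he i
  rw [Int.gcd_eq_natAbs, Int.natAbs_natCast] at h1 h2 ⊢
  have h : Nat.Coprime (L i).1.natAbs (d i * e i) := Nat.Coprime.mul_right h1 h2
  exact Nat.Coprime.coprime_dvd_right (Nat.lcm_dvd_mul (d i) (e i)) h

/-! ### Roots mod `p` and the «no contribution» clause -/

/-- Uniqueness of the root of `L = a n + b` mod `p` when `p ∤ a`.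
[cite: Maynard2016DenseClusters, §7 p. 13 (the residue class r_{p,a})] -/
theorem root_unique (l : ℤ × ℤ) {p : ℕ} (hp : p.Prime) (hpa : ¬ (p : ℤ) ∣ l.1) {n n' : ℤ}
    (hn : (p : ℤ) ∣ formEval l n) (hn' : (p : ℤ) ∣ formEval l n') : (p : ℤ) ∣ n - n' := by
  have hd : (p : ℤ) ∣ l.1 * (n - n') := by
    have e : l.1 * (n - n') = formEval l n - formEval l n' := by unfold formEval; ring
    rw [e]; exact dvd_sub hn hn'
  rcases (Nat.prime_iff_prime_int.1 hp).dvd_or_dvd hd with h | h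
  · exact absurd h hpa
  · exact h

/-- If `p ∣ n − n'` then `p ∣ L(n) ↔ p ∣ L(n')`. [cite: Maynard2016DenseClusters, §7 p. 13] -/
theorem dvd_formEval_iff_of_dvd_sub (l : ℤ × ℤ) {p : ℕ} {n n' : ℤ} (h : (p : ℤ) ∣ n - n') :
    (p : ℤ) ∣ formEval l n ↔ (p : ℤ) ∣ formEval l n' := by
  have e : formEval l n = formEval l n' + l.1 * (n - n') := by unfold formEval; ring
  rw [e]
  exact dvd_add_left (h.mul_left _)

/-- **«No contribution unless `(d_i e_i, d_j e_j) = 1`»**: for admissible `𝓛` and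
`d, e ∈ 𝒟_k(𝓛)`, if a prime `p` divides `d_i` and `e_j` with `i ≠ j`, then no integer `n` satisfies
`d_ι ∣ L_ι(n)` and `e_ι ∣ L_ι(n)` for all `ι` (by the index convention of `𝒟_k(𝓛)`: say `i < j`;
`p ∣ e_j` provides a root `n₁` of `L_j` with `p ∤ L_i(n₁)`, while `p ∣ L_i(n), L_j(n)` and the
uniqueness of the root of `L_j` force `n ≡ n₁`, so `p ∣ L_i(n₁)`).
[cite: Maynard2016DenseClusters, proof of Prop. 9.1 p. 19 («there is no contribution unless (d_ie_i, d_je_j) = 1 for all i ≠ j»); §7 p. 13] -/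
theorem joint_dvd_empty_of_not_cross_coprime {L : Fin k → ℤ × ℤ} (hadm : FormsAdmissible L)
    {B : ℕ} {R : ℝ} {d e : Fin k → ℕ} (hd : d ∈ dkBox L B R) (he : e ∈ dkBox L B R)
    {i j : Fin k} (hij : i ≠ j) {p : ℕ} (hp : p.Prime) (hpi : p ∣ d i) (hpj : p ∣ e j) (n : ℤ)
    (hdn : ∀ ι, ((d ι : ℕ) : ℤ) ∣ formEval (L ι) n) (hen : ∀ ι, ((e ι : ℕ) : ℤ) ∣ formEval (L ι) n) :
    False := by
  have hpdi : p ∈ (d i).primeFactors :=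
    Nat.mem_primeFactors.2 ⟨hp, hpi, Nat.one_le_iff_ne_zero.1 (one_le_of_mem_dkBox hd i)⟩
  have hpej : p ∈ (e j).primeFactors :=
    Nat.mem_primeFactors.2 ⟨hp, hpj, Nat.one_le_iff_ne_zero.1 (one_le_of_mem_dkBox he j)⟩
  have hpLi : (p : ℤ) ∣ formEval (L i) n := (Int.natCast_dvd_natCast.2 hpi).trans (hdn i)
  have hpLj : (p : ℤ) ∣ formEval (L j) n := (Int.natCast_dvd_natCast.2 hpj).trans (hen j)
  rcases lt_or_gt_of_ne hij with h | h
  · -- i < j: use the root of L_j supplied by e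
    obtain ⟨n₁, -, hn₁, hmin⟩ := exists_root_of_mem_dkBox he j hpej
    have hsub := root_unique (L j) hp (not_dvd_fst_of_mem_dkBox hadm he j hpej) hpLj hn₁
    exact hmin i h ((dvd_formEval_iff_of_dvd_sub (L i) hsub).1 hpLi)
  · -- j < i: use the root of L_i supplied by d
    obtain ⟨n₀, -, hn₀, hmin⟩ := exists_root_of_mem_dkBox hd i hpdi
    have hsub := root_unique (L i) hp (not_dvd_fst_of_mem_dkBox hadm hd i hpdi) hpLi hn₀
    exact hmin j h ((dvd_formEval_iff_of_dvd_sub (L j) hsub).1 hpLj)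

/-- **The dichotomy for a pair `d, e ∈ 𝒟_k(𝓛)`** (`𝓛` admissible): either `(d_i e_i, d_j e_j) = 1`
for all `i ≠ j`, or the joint divisibility conditions `d_ι, e_ι ∣ L_ι(n) ∀ι` have no solution `n`.
[cite: Maynard2016DenseClusters, proof of Prop. 9.1 p. 19] -/
theorem cross_coprime_or_empty {L : Fin k → ℤ × ℤ} (hadm : FormsAdmissible L) {B : ℕ} {R : ℝ}
    {d e : Fin k → ℕ} (hd : d ∈ dkBox L B R) (he : e ∈ dkBox L B R) :
    (Pairwise fun i j => (d i * e i).Coprime (d j * e j)) ∨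
      ∀ n : ℤ, ¬ ((∀ ι, ((d ι : ℕ) : ℤ) ∣ formEval (L ι) n) ∧
        ∀ ι, ((e ι : ℕ) : ℤ) ∣ formEval (L ι) n) := by
  by_cases hP : Pairwise fun i j => (d i * e i).Coprime (d j * e j)
  · exact Or.inl hP
  · refine Or.inr fun n hn => ?_
    apply hP
    intro i j hij
    refine Nat.Coprime.mul_left ?_ ?_ <;> refine Nat.Coprime.mul_right ?_ ?_
    · exact coprime_apply_of_mem_dkBox hd hij
    · exact Nat.coprime_of_dvd fun p hp hpi hpj =>
        joint_dvd_empty_of_not_cross_coprime hadm hd he hij hp hpi hpj n hn.1 hn.2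
    · refine Nat.coprime_of_dvd fun p hp hpi hpj => ?_
      exact joint_dvd_empty_of_not_cross_coprime hadm he hd hij hp hpi hpj n hn.2 hn.1
    · exact coprime_apply_of_mem_dkBox he hij

/-! ### The count for a cross-coprime pair -/

/-- `d ∣ x ∧ e ∣ x ↔ [d, e] ∣ x` in `ℤ` for natural `d, e`. [cite: Maynard2016DenseClusters, proof of Prop. 9.1 p. 19 ([d_i, e_i] ∣ L_i(n))] -/
theorem natCast_lcm_dvd_iff (d e : ℕ) (x : ℤ) :
    ((Nat.lcm d e : ℕ) : ℤ) ∣ x ↔ ((d : ℕ) : ℤ) ∣ x ∧ ((e : ℕ) : ℤ) ∣ x := by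
  rw [Int.natCast_dvd, Int.natCast_dvd, Int.natCast_dvd, Nat.lcm_dvd_iff]

/-- **The class count for a cross-coprime pair** `d, e ∈ 𝒟_k(𝓛)` (`𝓛` admissible), with
`W = ∏_{p ≤ 2k², p ∤ B} p` and `q = W ∏ [d_ι, e_ι]`:
`|#{n ∈ 𝒜(X) : (L_ι(n), W) = 1, d_ι ∣ L_ι(n), e_ι ∣ L_ι(n) ∀ι} − #𝒜(X) φ_ω(W)/q| ≤ φ_ω(W)`.
[cite: Maynard2016DenseClusters, proof of Prop. 9.1 p. 19, (9.1) («the inner sum is #𝒜(x; q, a) for some a and q = W[d,e]»)] -/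
theorem abs_card_dyadZ_pair_sub_le (X : ℝ) {L : Fin k → ℤ × ℤ} (hadm : FormsAdmissible L) {B : ℕ}
    {R : ℝ} {d e : Fin k → ℕ} (hd : d ∈ dkBox L B R) (he : e ∈ dkBox L B R)
    (hcross : Pairwise fun i j => (d i * e i).Coprime (d j * e j)) :
    |(#((dyadZ X).filter fun n : ℤ =>
          (∀ ι, Int.gcd (formEval (L ι) n) (wCut k B) = 1) ∧
            ∀ ι, ((d ι : ℕ) : ℤ) ∣ formEval (L ι) n ∧ ((e ι : ℕ) : ℤ) ∣ formEval (L ι) n) : ℝ) -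
        (#(dyadZ X) : ℝ) * phiOmega L (wCut k B) /
          ((wCut k B : ℝ) * ∏ ι, ((Nat.lcm (d ι) (e ι) : ℕ) : ℝ))| ≤ phiOmega L (wCut k B) := by
  classical
  have hm : ∀ ι, 0 < Nat.lcm (d ι) (e ι) :=
    fun ι => Nat.lcm_pos (one_le_of_mem_dkBox hd ι) (one_le_of_mem_dkBox he ι)
  have hmW : ∀ ι, (Nat.lcm (d ι) (e ι)).Coprime (wCut k B) := fun ι =>
    Nat.Coprime.coprime_dvd_left (Nat.lcm_dvd_mul _ _)
      (Nat.Coprime.mul_left (coprime_apply_wCut_of_mem_dkBox hd ι) (coprime_apply_wCut_of_mem_dkBox he ι))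
  have hmm : Pairwise fun i j => (Nat.lcm (d i) (e i)).Coprime (Nat.lcm (d j) (e j)) :=
    fun i j hij => Nat.Coprime.coprime_dvd_left (Nat.lcm_dvd_mul _ _)
      (Nat.Coprime.coprime_dvd_right (Nat.lcm_dvd_mul _ _) (hcross hij))
  have ham : ∀ ι, Int.gcd (L ι).1 (Nat.lcm (d ι) (e ι)) = 1 :=
    fun ι => intGcd_fst_lcm_eq_one_of_mem_dkBox hadm hd he ι
  have h := abs_card_dyadZ_localSystem_sub_le X L (squarefree_wCut k B) (fun ι => Nat.lcm (d ι) (e ι))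
    hm hmW hmm ham
  have hset : ((dyadZ X).filter fun n : ℤ =>
      (∀ ι, Int.gcd (formEval (L ι) n) (wCut k B) = 1) ∧
        ∀ ι, ((d ι : ℕ) : ℤ) ∣ formEval (L ι) n ∧ ((e ι : ℕ) : ℤ) ∣ formEval (L ι) n) =
      (dyadZ X).filter fun n : ℤ =>
        (∀ ι, Int.gcd (formEval (L ι) n) (wCut k B) = 1) ∧
          ∀ ι, ((Nat.lcm (d ι) (e ι) : ℕ) : ℤ) ∣ formEval (L ι) n := by
    refine Finset.filter_congr fun n _ => and_congr_right fun _ => forall_congr' fun ι => ?_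
    rw [natCast_lcm_dvd_iff]
  rw [hset]
  exact h

/-- The same count with the filter in the shape of `sum_sieveWt_eq`.
[cite: Maynard2016DenseClusters, proof of Prop. 9.1 p. 19, (9.1)] -/
theorem abs_card_dyadZ_pair_sub_le' (X : ℝ) {L : Fin k → ℤ × ℤ} (hadm : FormsAdmissible L) {B : ℕ}
    {R : ℝ} {d e : Fin k → ℕ} (hd : d ∈ dkBox L B R) (he : e ∈ dkBox L B R)
    (hcross : Pairwise fun i j => (d i * e i).Coprime (d j * e j)) :
    |(#((dyadZ X).filter fun n : ℤ =>
          (∀ i, Int.gcd (formEval (L i) n) (wCut k B) = 1) ∧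
            (∀ i, ((d i : ℕ) : ℤ) ∣ formEval (L i) n) ∧ ∀ i, ((e i : ℕ) : ℤ) ∣ formEval (L i) n) : ℝ) -
        (#(dyadZ X) : ℝ) * phiOmega L (wCut k B) /
          ((wCut k B : ℝ) * ∏ ι, ((Nat.lcm (d ι) (e ι) : ℕ) : ℝ))| ≤ phiOmega L (wCut k B) := by
  have h := abs_card_dyadZ_pair_sub_le X hadm hd he hcross
  have hset : ((dyadZ X).filter fun n : ℤ =>
      (∀ i, Int.gcd (formEval (L i) n) (wCut k B) = 1) ∧
        (∀ i, ((d i : ℕ) : ℤ) ∣ formEval (L i) n) ∧ ∀ i, ((e i : ℕ) : ℤ) ∣ formEval (L i) n) =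
      (dyadZ X).filter fun n : ℤ =>
        (∀ ι, Int.gcd (formEval (L ι) n) (wCut k B) = 1) ∧
          ∀ ι, ((d ι : ℕ) : ℤ) ∣ formEval (L ι) n ∧ ((e ι : ℕ) : ℤ) ∣ formEval (L ι) n := by
    refine Finset.filter_congr fun n _ => and_congr_right fun _ => ?_
    exact ⟨fun h ι => ⟨h.1 ι, h.2 ι⟩, fun h => ⟨fun ι => (h ι).1, fun ι => (h ι).2⟩⟩
  rw [hset]; exact h

/-- A pair `d, e ∈ 𝒟_k(𝓛)` that is not cross-coprime has an EMPTY class set (count `0`).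
[cite: Maynard2016DenseClusters, proof of Prop. 9.1 p. 19 («no contribution unless (d_ie_i, d_je_j) = 1»)] -/
theorem card_pair_filter_eq_zero (S : Finset ℤ) {L : Fin k → ℤ × ℤ} (hadm : FormsAdmissible L)
    {B : ℕ} {R : ℝ} {d e : Fin k → ℕ} (hd : d ∈ dkBox L B R) (he : e ∈ dkBox L B R)
    (hcross : ¬ Pairwise fun i j => (d i * e i).Coprime (d j * e j)) :
    #(S.filter fun n : ℤ => (∀ i, Int.gcd (formEval (L i) n) (wCut k B) = 1) ∧
        (∀ i, ((d i : ℕ) : ℤ) ∣ formEval (L i) n) ∧ ∀ i, ((e i : ℕ) : ℤ) ∣ formEval (L i) n) = 0 := by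
  rcases cross_coprime_or_empty hadm hd he with hP | hE
  · exact absurd hP hcross
  · exact Finset.card_eq_zero.2 (Finset.filter_eq_empty_iff.2 fun n _ hn => hE n ⟨hn.2.1, hn.2.2⟩)

/-- `φ_ω(W) ≥ 0`. [cite: Maynard2016DenseClusters, §7 p. 13 (φ_ω)] -/
theorem phiOmega_wCut_nonneg (L : Fin k → ℤ × ℤ) (B : ℕ) : 0 ≤ phiOmega L (wCut k B) := by
  rw [← cast_prod_sub_omegaL]; positivity

/-- **[Maynard2016DenseClusters, proof of Prop. 9.1, first step (p. 19) for `𝒜 = ℤ`]**: for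
admissible `𝓛`, ANY `F`, `W = ∏_{p ≤ 2k², p ∤ B} p`,
`|∑_{X<n≤2X} w_n − #𝒜(X) (φ_ω(W)/W) ∑_{d,e ∈ 𝒟_k, (d_ie_i,d_je_j)=1 ∀ i≠j} λ_d λ_e/∏[d_i,e_i]| ≤ φ_ω(W) (∑_d |λ_d|)²`
(the cross-coprimality condition is spelled `∀ i j, i ≠ j → (d_i e_i).Coprime (d_j e_j)`, i.e. `Pairwise …` unfolded, so
that the `if` is decidable):
expand `w_n` (`sum_sieveWt_eq`), count each cross-coprime pair's classes with
`abs_card_dyadZ_pair_sub_le'` (error `≤ φ_ω(W)` per pair) and drop the other pairs, whose class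
sets are empty (`card_pair_filter_eq_zero`). What remains for Proposition 9.1 is the evaluation
of the quadratic form (change of variables (9.2)–(9.5) + Lemma 8.4) and `∑_d |λ_d| ≤ λ_max
#{d : ∏dᵢ < R}` (Lemma 8.5 (i), `card_dkBox_filter_prod_lt_le`).
[cite: Maynard2016DenseClusters, proof of Prop. 9.1 p. 19, (9.1); FordGreenKonyaginMaynardTao2018, Theorem 6 (i) proof p. 21] -/
theorem abs_sum_sieveWt_sub_quadForm_le (X : ℝ) {L : Fin k → ℤ × ℤ} (hadm : FormsAdmissible L)
    (B : ℕ) (R : ℝ) (F : (Fin k → ℝ) → ℝ) :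
    |∑ n ∈ dyadZ X, sieveWt L B R F n -
        (#(dyadZ X) : ℝ) * phiOmega L (wCut k B) / (wCut k B : ℝ) *
          ∑ d ∈ dkBox L B R, ∑ e ∈ dkBox L B R,
            (if ∀ i j, i ≠ j → (d i * e i).Coprime (d j * e j) then
              lamVar L B R F d * lamVar L B R F e / ∏ i, ((Nat.lcm (d i) (e i) : ℕ) : ℝ) else 0)|
      ≤ phiOmega L (wCut k B) * (∑ d ∈ dkBox L B R, |lamVar L B R F d|) ^ 2 := by
  classical
  set box := dkBox L B R with hbox
  set φW := phiOmega L (wCut k B) with hφW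
  set A : ℝ := (#(dyadZ X) : ℝ) with hA
  have hφ0 : 0 ≤ φW := phiOmega_wCut_nonneg L B
  -- the summand-wise bound
  have key : ∀ d ∈ box, ∀ e ∈ box,
      |lamVar L B R F d * lamVar L B R F e *
            (#((dyadZ X).filter fun n : ℤ => (∀ i, Int.gcd (formEval (L i) n) (wCut k B) = 1) ∧
                (∀ i, ((d i : ℕ) : ℤ) ∣ formEval (L i) n) ∧ ∀ i, ((e i : ℕ) : ℤ) ∣ formEval (L i) n) : ℝ) -
          A * φW / (wCut k B : ℝ) *
            (if ∀ i j, i ≠ j → (d i * e i).Coprime (d j * e j) then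
              lamVar L B R F d * lamVar L B R F e / ∏ i, ((Nat.lcm (d i) (e i) : ℕ) : ℝ) else 0)|
        ≤ φW * (|lamVar L B R F d| * |lamVar L B R F e|) := by
    intro d hd e he
    split_ifs with hP
    · have h := abs_card_dyadZ_pair_sub_le' X hadm hd he hP
      have e1 : lamVar L B R F d * lamVar L B R F e *
            (#((dyadZ X).filter fun n : ℤ => (∀ i, Int.gcd (formEval (L i) n) (wCut k B) = 1) ∧
                (∀ i, ((d i : ℕ) : ℤ) ∣ formEval (L i) n) ∧ ∀ i, ((e i : ℕ) : ℤ) ∣ formEval (L i) n) : ℝ) -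
          A * φW / (wCut k B : ℝ) *
            (lamVar L B R F d * lamVar L B R F e / ∏ i, ((Nat.lcm (d i) (e i) : ℕ) : ℝ)) =
          lamVar L B R F d * lamVar L B R F e *
            ((#((dyadZ X).filter fun n : ℤ => (∀ i, Int.gcd (formEval (L i) n) (wCut k B) = 1) ∧
                (∀ i, ((d i : ℕ) : ℤ) ∣ formEval (L i) n) ∧ ∀ i, ((e i : ℕ) : ℤ) ∣ formEval (L i) n) : ℝ) -
              A * φW / ((wCut k B : ℝ) * ∏ ι, ((Nat.lcm (d ι) (e ι) : ℕ) : ℝ))) := by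
        ring
      rw [e1, abs_mul, abs_mul, mul_comm φW]
      exact mul_le_mul_of_nonneg_left h (by positivity)
    · rw [card_pair_filter_eq_zero (dyadZ X) hadm hd he hP]
      simp only [Nat.cast_zero, mul_zero, sub_zero, abs_zero]
      positivity
  -- assemble
  rw [sum_sieveWt_eq, Finset.mul_sum, ← Finset.sum_sub_distrib]
  have hrhs : φW * (∑ d ∈ box, |lamVar L B R F d|) ^ 2 =
      ∑ d ∈ box, ∑ e ∈ box, φW * (|lamVar L B R F d| * |lamVar L B R F e|) := by
    rw [sq, Finset.sum_mul_sum, Finset.mul_sum]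
    refine Finset.sum_congr rfl fun d _ => ?_
    rw [Finset.mul_sum]
  rw [hrhs]
  refine (Finset.abs_sum_le_sum_abs _ _).trans (Finset.sum_le_sum fun d hd => ?_)
  rw [Finset.mul_sum, ← Finset.sum_sub_distrib]
  refine (Finset.abs_sum_le_sum_abs _ _).trans (Finset.sum_le_sum fun e he => ?_)
  exact key d hd e he

end Literature.NumberTheory.Sieve.FGKMT2018
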